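import Literature.NumberTheory.NumberFields.QuadraticGenusTwoRankBound
import Literature.NumberTheory.NumberFields.AmbiguousClassNumberFormula
import Literature.NumberTheory.NumberFields.AmbiguousClassIndexFormula
import Literature.NumberTheory.NumberFields.HilbertTheorem92
import Mathlib.GroupTheory.Perm.Cycle.Type
import HarnessLib

/-!
# The EXACT `2`-rank of the class group in a quadratic extension with ODD base class number (Gras IV.4):
# `ord₂ [Cl(L) : Cl(L)²] + 1 + ord₂ [E_K : E_K ∩ N_{L/K} Lˣ] = ord₂ (∏_𝔭 e_𝔭 · ∏_{v∣∞} e_v)`, i.e. `rank₂ Cl(L) = t − 1 + log₂ e_∞ − r_E`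

Topic `NumberTheory/NumberFields`; namespace `Literature.NumberTheory.NumberFields.AmbiguousClass`.  THEOREM-ONLY file (no definition, no named fact, no
instance, no `sorry`), written by the prover seat `bsd-line-att-p3` g40 (cell `bsd-f1-sign2`, route `AlignedTransportAtTwo`; `--supports`
stmt-BirchSwinnertonDyer-22298, closes nothing).  It upgrades cell bsd-2adic's `QuadraticGenusTwoRankBound` («only `≤` is proved here») to the EQUALITY.

THE THEOREM.  `L/K` Galois of degree `2`, `h_K` odd, `σ` the generator.  (1) `ord₂ #Cl(L)^G = ord₂ [Cl(L) : Cl(L)²]` (`padicValNat_two_card_fixed_eq`): the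
`2`-torsion classes are ambiguous (`c² = 1 ⟹ (c·σc)² = 1`, and `c·σc = i(Nc)` has odd order, so `σc = c⁻¹ = c`), and the ambiguous classes modulo the
`2`-torsion ones form a group of odd order (`c = σc ⟹ c² = i(Nc)` of odd order); `#Cl(L)[2] = [Cl(L) : Cl(L)²]`.  (2) Chevalley's formula (tree
`ambiguousClassNumberFormula`: `#Cl(L)^G · [L:K] · [E_K : E_K ∩ NLˣ] = h_K · ∏_𝔭 e_𝔭 · e_∞`) read `2`-adically:
**`ord₂ [Cl(L):Cl(L)²] + 1 + ord₂ [E_K : E_K ∩ NLˣ] = ord₂ ∏_𝔭 e_𝔭 + ord₂ e_∞`** (`padicValNat_two_index_pow_two_add_eq_of_odd_classNumber`); unramified at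
infinity with `t` ramified primes: `… = t`; and, with the tree's `≤`, the closed form **`[Cl(L):Cl(L)²] · 2 · 2^{ord₂[E_K : E_K ∩ NLˣ]} = 2^t`**
(`index_pow_two_mul_two_mul_pow_eq_of_odd_classNumber`): `rank₂ Cl(L) = t − 1 − r_E` EXACTLY.

USE (cell bsd-f1-sign2, the first layer `F_1 = F(√2)` of the cyclotomic `ℤ₂`-tower of a cubic field `F` with `h_F` odd): `rank₂ Cl(F_1) = t − 1 − r_E` with
`t` = number of primes of `F` ramified in `F(√2)` and `2^{r_E} = [E_F : E_F ∩ N F_1ˣ]` (a complex cubic: `E_F = ±ε^ℤ`, `−1 = N(1+√2)`, so `r_E = [ε ∉ NF_1ˣ] ∈ {0,1}`;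
three primes above `2`: `rank₂ Cl(F_1) = 2 − r_E`) — the lower layer of the rank-jump door `ClassGroupPRankStableOfRankJumpLt` at the pair `(1,2)`.

References: [Gras2003] G. Gras, *Class Field Theory*, IV.4 (genus theory; `rank₂` in the odd-`h_K` case); [Lang1990] Ch. 13 §4 Lemma 4.1 (Chevalley);
[NeukirchANT1999] Ch. III §1 Prop. (1.6) (iv).
-/

set_option autoImplicit false

noncomputable section

open scoped NumberField

namespace Literature.NumberTheory.NumberFields.AmbiguousClass

open _root_.NumberField _root_.IsDedekindDomain
open Literature.NumberTheory.GaloisRepresentations Literature.NumberTheory.GaloisRepresentations.Herbrand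
  Literature.NumberTheory.GaloisRepresentations.MinkowskiUnit
  Literature.NumberTheory.GaloisRepresentations.CyclicNormIndex

/-! ## §1 Finite abelian groups: an endomorphism `f` with `c · f(c)` of odd order for every `c` -/

section Group

variable {B : Type*} [CommGroup B] [Finite B]

/-- A finite group all of whose elements have odd order has odd cardinality (Cauchy). [folklore] -/
private theorem odd_card_of_forall_odd_orderOf {H : Type*} [Group H] [Finite H] (h : ∀ x : H, Odd (orderOf x)) :
    Odd (Nat.card H) := by
  haveI : Fact (Nat.Prime 2) := ⟨Nat.prime_two⟩
  by_contra heven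
  rw [Nat.not_odd_iff_even, even_iff_two_dvd] at heven
  obtain ⟨x, hx⟩ := exists_prime_orderOf_dvd_card' 2 heven
  have := h x
  rw [hx] at this
  exact (Nat.not_even_iff_odd.mpr this) even_two

/-- `#B[2] = [B : B²]` for a finite abelian group (kernel and cokernel of squaring have the same order). [folklore] -/
private theorem card_ker_pow_two_eq_index :
    Nat.card (powMonoidHom 2 : B →* B).ker = (powMonoidHom 2 : B →* B).range.index := by
  have h1 : Nat.card B = Nat.card (B ⧸ (powMonoidHom 2 : B →* B).ker) * Nat.card (powMonoidHom 2 : B →* B).ker :=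
    Subgroup.card_eq_card_quotient_mul_card_subgroup _
  have h2 : Nat.card (B ⧸ (powMonoidHom 2 : B →* B).ker) = Nat.card (powMonoidHom 2 : B →* B).range :=
    Nat.card_congr (QuotientGroup.quotientKerEquivRange (powMonoidHom 2 : B →* B)).toEquiv
  have h3 := (powMonoidHom 2 : B →* B).range.card_mul_index
  rw [h2] at h1
  have hpos : 0 < Nat.card (powMonoidHom 2 : B →* B).range := Nat.card_pos
  refine Nat.eq_of_mul_eq_mul_left hpos ?_
  rw [h3, h1]

/-- ★ **`ord₂ #{c : f c = c} = ord₂ [B : B²]`** for a finite abelian group `B` and an endomorphism `f` such that `c · f(c)` has ODD order for every `c`: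
the `2`-torsion is fixed (`(c·fc)² = 1` forces `c·fc = 1`, `fc = c⁻¹ = c`) and the fixed subgroup modulo `B[2]` — the image of squaring on it, whose elements
`c² = c·fc` have odd order — has odd order; `#B[2] = [B : B²]`. [folklore] -/
private theorem padicValNat_two_card_fixed_eq_of_odd (f : B →* B) (hodd : ∀ c : B, Odd (orderOf (c * f c))) :
    padicValNat 2 (Nat.card {c : B // f c = c}) = padicValNat 2 (powMonoidHom 2 : B →* B).range.index := by
  classical
  haveI : Fact (Nat.Prime 2) := ⟨Nat.prime_two⟩
  -- the fixed subgroup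
  let H : Subgroup B :=
    { carrier := {c | f c = c}
      mul_mem' := fun {a b} ha hb => by
        simp only [Set.mem_setOf_eq] at ha hb ⊢
        rw [map_mul, ha, hb]
      one_mem' := by simp only [Set.mem_setOf_eq, map_one]
      inv_mem' := fun {a} ha => by
        simp only [Set.mem_setOf_eq] at ha ⊢
        rw [map_inv, ha] }
  have hmemH : ∀ c : B, c ∈ H ↔ f c = c := fun c => Iff.rfl
  have hcardH : Nat.card {c : B // f c = c} = Nat.card H := Nat.card_congr (Equiv.refl _)
  -- `2`-torsion elements are fixed
  have h2tor : ∀ b : B, b ^ 2 = 1 → f b = b := by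
    intro b hb
    have h2 : (b * f b) ^ 2 = 1 := by rw [mul_pow, ← map_pow, hb, map_one, one_mul]
    have hdvd : orderOf (b * f b) ∣ 2 := orderOf_dvd_of_pow_eq_one h2
    have h1 : orderOf (b * f b) = 1 := by
      rcases (Nat.dvd_prime Nat.prime_two).mp hdvd with h | h
      · exact h
      · exfalso
        have := hodd b
        rw [h] at this
        exact (Nat.not_even_iff_odd.mpr this) even_two
    rw [orderOf_eq_one_iff] at h1
    have hinv : f b = b⁻¹ := eq_inv_of_mul_eq_one_right h1
    rw [hinv, inv_eq_iff_mul_eq_one, ← pow_two, hb]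
  -- squaring on `H`; its kernel is all of `B[2]`, its range has odd order
  let s : H →* B := (powMonoidHom 2 : B →* B).comp H.subtype
  have hs : ∀ y : H, s y = (y : B) ^ 2 := fun _ => rfl
  have hker : Nat.card s.ker = Nat.card (powMonoidHom 2 : B →* B).ker := by
    refine Nat.card_congr
      ⟨fun x => ⟨x.1.1, by
          have hx := x.2
          rw [MonoidHom.mem_ker, hs] at hx
          rw [MonoidHom.mem_ker, powMonoidHom_apply]
          exact hx⟩,
        fun y => ⟨⟨y.1, (hmemH _).mpr (h2tor y.1 (by
          have hy := y.2
          rwa [MonoidHom.mem_ker, powMonoidHom_apply] at hy))⟩, by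
          have hy := y.2
          rw [MonoidHom.mem_ker, powMonoidHom_apply] at hy
          rw [MonoidHom.mem_ker, hs]
          exact hy⟩,
        fun x => Subtype.ext (Subtype.ext rfl), fun y => Subtype.ext rfl⟩
  have hrange_odd : Odd (Nat.card s.range) := by
    refine odd_card_of_forall_odd_orderOf fun x => ?_
    obtain ⟨⟨c, hc⟩, hx⟩ := MonoidHom.mem_range.mp x.2
    have hc' : f c = c := (hmemH c).mp hc
    have hx' : (x : B) = c * f c := by rw [hc', ← pow_two]; exact hx.symm.trans (hs ⟨c, hc⟩)
    rw [← Subgroup.orderOf_coe x, hx']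
    exact hodd c
  -- `#H = #ker s · #range s`
  have hH : Nat.card H = Nat.card s.range * Nat.card s.ker := by
    rw [Subgroup.card_eq_card_quotient_mul_card_subgroup s.ker,
      Nat.card_congr (QuotientGroup.quotientKerEquivRange s).toEquiv]
  rw [hcardH, hH, hker, card_ker_pow_two_eq_index,
    padicValNat.mul (Nat.card_pos (α := s.range)).ne' Subgroup.index_ne_zero_of_finite,
    padicValNat.eq_zero_of_not_dvd (Odd.not_two_dvd_nat hrange_odd), zero_add]

end Group

/-! ## §2 Quadratic `L/K` with `h_K` odd: `ord₂ #Cl(L)^G = rank₂ Cl(L)` -/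

variable {K L : Type} [Field K] [NumberField K] [Field L] [NumberField L] [Algebra K L]

/-- ★ **`ord₂ #Cl(L)^{Gal(L/K)} = ord₂ [Cl(L) : Cl(L)²]`** for `L/K` Galois quadratic with `h_K` odd: with `Gal(L/K) = {1, σ}`, `c · σc = i_{L/K}(N_{L/K} c)`
(Neukirch III (1.6)(iv)) has order dividing `h_K`, hence odd, and §1 applies to `f = σ`. [cite: Gras2003, IV.4] [cite: NeukirchANT1999, Ch. III §1 Prop. (1.6) (iv)] -/
theorem padicValNat_two_card_fixed_eq [IsGalois K L] (hdeg : Module.finrank K L = 2) (hodd : Odd (classNumber K)) :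
    padicValNat 2 (Nat.card {c : ClassGroup (𝓞 L) // ∀ τ : L ≃ₐ[K] L, ClassGroup.mulEquiv (intAut τ) c = c}) =
      padicValNat 2 (powMonoidHom 2 : ClassGroup (𝓞 L) →* ClassGroup (𝓞 L)).range.index := by
  classical
  haveI : FiniteDimensional K L := Module.Finite.of_restrictScalars_finite ℚ K L
  have hcard : Fintype.card (L ≃ₐ[K] L) = 2 := by rw [← Nat.card_eq_fintype_card, IsGalois.card_aut_eq_finrank, hdeg]
  -- a non-trivial automorphism `σ`; `Gal = {1, σ}`
  haveI : Nontrivial (L ≃ₐ[K] L) := Fintype.one_lt_card_iff_nontrivial.mp (by rw [hcard]; norm_num)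
  obtain ⟨σ, hσ1⟩ := exists_ne (1 : L ≃ₐ[K] L)
  have huniv : (Finset.univ : Finset (L ≃ₐ[K] L)) = {1, σ} := by
    symm
    apply Finset.eq_univ_of_card
    rw [Finset.card_pair (Ne.symm hσ1), hcard]
  have hmem : ∀ τ : L ≃ₐ[K] L, τ = 1 ∨ τ = σ := fun τ => by
    have : τ ∈ (Finset.univ : Finset (L ≃ₐ[K] L)) := Finset.mem_univ τ
    rw [huniv, Finset.mem_insert, Finset.mem_singleton] at this
    exact this
  -- fixed by all `τ` iff fixed by `σ`
  set f : ClassGroup (𝓞 L) →* ClassGroup (𝓞 L) := (ClassGroup.mulEquiv (intAut σ)).toMonoidHom with hf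
  have hiff : ∀ c : ClassGroup (𝓞 L), (∀ τ : L ≃ₐ[K] L, ClassGroup.mulEquiv (intAut τ) c = c) ↔ f c = c := by
    intro c
    refine ⟨fun h => h σ, fun h τ => ?_⟩
    rcases hmem τ with rfl | rfl
    · rw [mulEquiv_intAut_one, MulEquiv.refl_apply]
    · exact h
  have hcongr : Nat.card {c : ClassGroup (𝓞 L) // ∀ τ : L ≃ₐ[K] L, ClassGroup.mulEquiv (intAut τ) c = c} =
      Nat.card {c : ClassGroup (𝓞 L) // f c = c} :=
    Nat.card_congr (Equiv.subtypeEquivRight hiff)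
  rw [hcongr]
  refine padicValNat_two_card_fixed_eq_of_odd f fun c => ?_
  -- `c · σc = i(N c)` has odd order
  have hP : c * f c = classGroupExtend K L (classGroupNorm K L c) := by
    rw [classGroupExtend_classGroupNorm_eq_prod K L c, huniv, Finset.prod_pair (Ne.symm hσ1), mulEquiv_intAut_one,
      MulEquiv.refl_apply, hf, MulEquiv.coe_toMonoidHom]
  rw [hP]
  have h1 : orderOf (classGroupExtend K L (classGroupNorm K L c)) ∣ orderOf (classGroupNorm K L c) := orderOf_map_dvd _ _
  have h2 : orderOf (classGroupNorm K L c) ∣ classNumber K := by rw [classNumber]; exact orderOf_dvd_card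
  exact Odd.of_dvd_nat hodd (h1.trans h2)

/-! ## §3 The exact genus `2`-rank -/

/-- ★★ **THE EXACT `2`-RANK (Gras IV.4).**  `L/K` Galois of degree `2` with `h_K` odd:
**`ord₂ [Cl(L) : Cl(L)²] + 1 + ord₂ [E_K : E_K ∩ N_{L/K} Lˣ] = ord₂ (∏_𝔭 e_𝔭) + ord₂ (∏_{v∣∞} e_v)`** — Chevalley's ambiguous class number formula
(tree `ambiguousClassNumberFormula`) read `2`-adically through §2.  The tree's `index_pow_two_mul_le_genus_of_odd_classNumber` is the inequality `≤` of
the underlying integers. [cite: Gras2003, IV.4] [cite: Lang1990, Ch. 13 §4, Lemma 4.1 (PDF p. 203)] -/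
theorem padicValNat_two_index_pow_two_add_eq_of_odd_classNumber [IsGalois K L] (hdeg : Module.finrank K L = 2)
    (hodd : Odd (classNumber K)) :
    padicValNat 2 (powMonoidHom 2 : ClassGroup (𝓞 L) →* ClassGroup (𝓞 L)).range.index + 1 +
        padicValNat 2 ((unitsE L ⊓ (⊤ : Subgroup Lˣ).map (Herbrand.norm (L ≃ₐ[K] L))).relIndex
          (unitsE L ⊓ (unitsIncl K L).range)) =
      padicValNat 2 (∏ᶠ v : HeightOneSpectrum (𝓞 K), v.asIdeal.ramificationIdxIn (𝓞 L)) +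
        padicValNat 2 (ArchHerbrand.archFactor K L) := by
  classical
  haveI : FiniteDimensional K L := Module.Finite.of_restrictScalars_finite ℚ K L
  haveI : Fact (Nat.Prime 2) := ⟨Nat.prime_two⟩
  have hcard : Nat.card (L ≃ₐ[K] L) = 2 := by rw [IsGalois.card_aut_eq_finrank, hdeg]
  haveI : IsCyclic (L ≃ₐ[K] L) := isCyclic_of_prime_card hcard
  obtain ⟨σ, hσ⟩ := IsCyclic.exists_generator (α := L ≃ₐ[K] L)
  have hchev := ambiguousClassNumberFormula hσ
  rw [hdeg] at hchev
  have hfix : Nat.card {c : ClassGroup (𝓞 L) // ∀ τ : L ≃ₐ[K] L, ClassGroup.mulEquiv (intAut τ) c = c} ≠ 0 := by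
    haveI : Finite {c : ClassGroup (𝓞 L) // ∀ τ : L ≃ₐ[K] L, ClassGroup.mulEquiv (intAut τ) c = c} := inferInstance
    haveI : Nonempty {c : ClassGroup (𝓞 L) // ∀ τ : L ≃ₐ[K] L, ClassGroup.mulEquiv (intAut τ) c = c} := ⟨⟨1, fun τ => map_one _⟩⟩
    exact Nat.card_pos.ne'
  have hidx := (relIndex_unitsNorm_ne_zero hσ).1
  have hhK : classNumber K ≠ 0 := by rw [classNumber]; exact Fintype.card_ne_zero
  have harch : ArchHerbrand.archFactor K L ≠ 0 := ArchHerbrand.archFactor_ne_zero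
  have hprod : (∏ᶠ v : HeightOneSpectrum (𝓞 K), v.asIdeal.ramificationIdxIn (𝓞 L)) ≠ 0 := by
    rw [finprod_ramificationIdxIn_eq_pow_of_prime Nat.prime_two hdeg]; exact pow_ne_zero _ two_ne_zero
  have h := congrArg (padicValNat 2) hchev
  rw [padicValNat.mul (mul_ne_zero hfix two_ne_zero) hidx, padicValNat.mul hfix two_ne_zero,
    padicValNat.mul (mul_ne_zero hhK hprod) harch, padicValNat.mul hhK hprod, padicValNat.self one_lt_two,
    padicValNat.eq_zero_of_not_dvd (Odd.not_two_dvd_nat hodd), zero_add, padicValNat_two_card_fixed_eq hdeg hodd] at h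
  exact h

/-- ★★ **Unramified at infinity, `t` ramified primes: `ord₂ [Cl(L) : Cl(L)²] + 1 + ord₂ [E_K : E_K ∩ N Lˣ] = t`** (`rank₂ Cl(L) = t − 1 − r_E`, Gras IV.4).
[cite: Gras2003, IV.4] [cite: Lang1990, Ch. 13 §4, Lemma 4.1 and proof of Lemma 4.2 (PDF pp. 203–204)] -/
theorem padicValNat_two_index_pow_two_add_eq_ncard_of_odd_classNumber [IsGalois K L] [IsUnramifiedAtInfinitePlaces K L]
    (hdeg : Module.finrank K L = 2) (hodd : Odd (classNumber K)) :
    padicValNat 2 (powMonoidHom 2 : ClassGroup (𝓞 L) →* ClassGroup (𝓞 L)).range.index + 1 +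
        padicValNat 2 ((unitsE L ⊓ (⊤ : Subgroup Lˣ).map (Herbrand.norm (L ≃ₐ[K] L))).relIndex
          (unitsE L ⊓ (unitsIncl K L).range)) =
      {v : HeightOneSpectrum (𝓞 K) | v.asIdeal.ramificationIdxIn (𝓞 L) ≠ 1}.ncard := by
  haveI : Fact (Nat.Prime 2) := ⟨Nat.prime_two⟩
  have h := padicValNat_two_index_pow_two_add_eq_of_odd_classNumber hdeg hodd
  rwa [archFactor_eq_one, padicValNat_one_right, add_zero, finprod_ramificationIdxIn_eq_pow_of_prime Nat.prime_two hdeg,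
    padicValNat.prime_pow] at h

/-- ★★ **Closed form: `[Cl(L) : Cl(L)²] · 2 · 2^{ord₂ [E_K : E_K ∩ N Lˣ]} = 2^t`** for `L/K` Galois quadratic, unramified at infinity, `h_K` odd, `N_{L/K}` onto
(e.g. `t ≥ 1`): the `2`-adic equality of the previous theorem together with the tree's inequality `[Cl(L):Cl(L)²]·2·[E_K : E_K ∩ NLˣ] ≤ 2^t` (which kills the odd part
of the index).  So `rank₂ Cl(L) = t − 1 − r_E` EXACTLY. [cite: Gras2003, IV.4] [cite: Lang1990, Ch. 13 §4, Lemma 4.1 and proof of Lemma 4.2 (PDF pp. 203–204)] -/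
theorem index_pow_two_mul_two_mul_pow_eq_of_odd_classNumber [IsGalois K L] [IsUnramifiedAtInfinitePlaces K L]
    (hdeg : Module.finrank K L = 2) (hodd : Odd (classNumber K)) (hN : Function.Surjective (classGroupNorm K L)) :
    (powMonoidHom 2 : ClassGroup (𝓞 L) →* ClassGroup (𝓞 L)).range.index * 2 *
        2 ^ padicValNat 2 ((unitsE L ⊓ (⊤ : Subgroup Lˣ).map (Herbrand.norm (L ≃ₐ[K] L))).relIndex
          (unitsE L ⊓ (unitsIncl K L).range)) =
      2 ^ {v : HeightOneSpectrum (𝓞 K) | v.asIdeal.ramificationIdxIn (𝓞 L) ≠ 1}.ncard := by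
  classical
  haveI : Fact (Nat.Prime 2) := ⟨Nat.prime_two⟩
  haveI : FiniteDimensional K L := Module.Finite.of_restrictScalars_finite ℚ K L
  have hcard : Nat.card (L ≃ₐ[K] L) = 2 := by rw [IsGalois.card_aut_eq_finrank, hdeg]
  haveI : IsCyclic (L ≃ₐ[K] L) := isCyclic_of_prime_card hcard
  obtain ⟨σ, hσ⟩ := IsCyclic.exists_generator (α := L ≃ₐ[K] L)
  set I := (powMonoidHom 2 : ClassGroup (𝓞 L) →* ClassGroup (𝓞 L)).range.index with hI
  set u := (unitsE L ⊓ (⊤ : Subgroup Lˣ).map (Herbrand.norm (L ≃ₐ[K] L))).relIndex (unitsE L ⊓ (unitsIncl K L).range)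
    with hu
  set t := {v : HeightOneSpectrum (𝓞 K) | v.asIdeal.ramificationIdxIn (𝓞 L) ≠ 1}.ncard with ht
  have hval := padicValNat_two_index_pow_two_add_eq_ncard_of_odd_classNumber hdeg hodd
  have hle := index_pow_two_mul_le_pow_of_odd_classNumber hdeg hodd hN
  rw [← hI, ← hu, ← ht] at hval hle
  have hI0 : I ≠ 0 := Subgroup.index_ne_zero_of_finite
  have hu0 : u ≠ 0 := (relIndex_unitsNorm_ne_zero hσ).1
  -- `I = 2^a · m`, `u = 2^b · m'` with `m, m'` odd; `a + 1 + b = t` and `I · 2 · u ≤ 2^t` force `m = m' = 1`... we only need `m = 1`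
  obtain ⟨a, m, hm2, hIam⟩ := Nat.exists_eq_two_pow_mul_odd hI0
  obtain ⟨b, m', hm'2, hubm⟩ := Nat.exists_eq_two_pow_mul_odd hu0
  have ha : padicValNat 2 I = a := by
    rw [hIam, padicValNat.mul (pow_ne_zero _ two_ne_zero) hm2.pos.ne', padicValNat.prime_pow,
      padicValNat.eq_zero_of_not_dvd (Odd.not_two_dvd_nat hm2), add_zero]
  have hb : padicValNat 2 u = b := by
    rw [hubm, padicValNat.mul (pow_ne_zero _ two_ne_zero) hm'2.pos.ne', padicValNat.prime_pow,
      padicValNat.eq_zero_of_not_dvd (Odd.not_two_dvd_nat hm'2), add_zero]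
  rw [ha, hb] at hval
  rw [hb]
  -- from `hle`: `2^a m · 2 · 2^b m' ≤ 2^t = 2^(a+1+b)`, so `m · m' ≤ 1`, so `m = 1`
  have hm1 : 1 ≤ m := hm2.pos
  have hm'1 : 1 ≤ m' := hm'2.pos
  have hpow : 2 ^ t = 2 ^ a * 2 * 2 ^ b := by rw [← hval, pow_add, pow_add, pow_one]
  rw [hIam, hubm, hpow] at hle
  have hmm : m * m' ≤ 1 := by
    have h2pos : 0 < 2 ^ a * 2 * 2 ^ b := by positivity
    have : 2 ^ a * 2 * 2 ^ b * (m * m') ≤ 2 ^ a * 2 * 2 ^ b * 1 := by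
      calc 2 ^ a * 2 * 2 ^ b * (m * m') = 2 ^ a * m * 2 * (2 ^ b * m') := by ring
        _ ≤ 2 ^ a * 2 * 2 ^ b := hle
        _ = 2 ^ a * 2 * 2 ^ b * 1 := (mul_one _).symm
    exact Nat.le_of_mul_le_mul_left this h2pos
  have hmle : m ≤ m * m' := Nat.le_mul_of_pos_right m hm'1
  have hm : m = 1 := by omega
  rw [hIam, hm, mul_one, hpow]


/-! ## §4 `h_K` odd replaced by CAPITULATION of the `2`-primary part of `Cl(K)` (appended by att-p3 g45, same seat lineage)

If every class of `K` of `2`-power order dies in `Cl(L)`, then `c · σc = i_{L/K}(N_{L/K} c)` still has ODD order for every class `c` of `L`, so §1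
applies verbatim and Chevalley's formula read `2`-adically keeps the term `ord₂ h_K`:
**`ord₂ [Cl(L):Cl(L)²] + 1 + ord₂ [E_K : E_K ∩ N Lˣ] = ord₂ h_K + ord₂ ∏_𝔭 e_𝔭 + ord₂ e_∞`**.  USE (cell bsd-f1-sign2, crux C2, the layer `K_2/K_1` of the
cyclotomic `ℤ₂`-tower of a complex cubic field with `ord₂ h(K_1) = 1`): capitulation of the class of order two ⟹ `rank₂ Cl(K_2) ≤ 2` ⟹ the `(0,2)`
rank-jump door.  Nearest print for the shape: Greenberg, Amer. J. Math. 98 (1976) §4 (totally real fields). -/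

/-- ★ **`ord₂ #Cl(L)^{Gal(L/K)} = ord₂ [Cl(L) : Cl(L)²]` when the `2`-part of `Cl(K)` CAPITULATES in `L`** (`L/K` Galois quadratic): `c · σc = i(Nc)` has
odd order (`ord(Nc) = 2^a·m`, `m` odd: `(Nc)^m` capitulates, so `(i Nc)^m = 1`), and §1 applies. Generalises `padicValNat_two_card_fixed_eq`.
[cite: Gras2003, IV.4] [cite: NeukirchANT1999, Ch. III §1 Prop. (1.6) (iv)] [cite: Greenberg1976, §4] -/
theorem padicValNat_two_card_fixed_eq_of_capitulation [IsGalois K L] (hdeg : Module.finrank K L = 2)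
    (hcap : ∀ d : ClassGroup (𝓞 K), (∃ k : ℕ, orderOf d = 2 ^ k) → classGroupExtend K L d = 1) :
    padicValNat 2 (Nat.card {c : ClassGroup (𝓞 L) // ∀ τ : L ≃ₐ[K] L, ClassGroup.mulEquiv (intAut τ) c = c}) =
      padicValNat 2 (powMonoidHom 2 : ClassGroup (𝓞 L) →* ClassGroup (𝓞 L)).range.index := by
  classical
  haveI : FiniteDimensional K L := Module.Finite.of_restrictScalars_finite ℚ K L
  have hcard : Fintype.card (L ≃ₐ[K] L) = 2 := by rw [← Nat.card_eq_fintype_card, IsGalois.card_aut_eq_finrank, hdeg]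
  haveI : Nontrivial (L ≃ₐ[K] L) := Fintype.one_lt_card_iff_nontrivial.mp (by rw [hcard]; norm_num)
  obtain ⟨σ, hσ1⟩ := exists_ne (1 : L ≃ₐ[K] L)
  have huniv : (Finset.univ : Finset (L ≃ₐ[K] L)) = {1, σ} := by
    symm
    apply Finset.eq_univ_of_card
    rw [Finset.card_pair (Ne.symm hσ1), hcard]
  have hmem : ∀ τ : L ≃ₐ[K] L, τ = 1 ∨ τ = σ := fun τ => by
    have : τ ∈ (Finset.univ : Finset (L ≃ₐ[K] L)) := Finset.mem_univ τ
    rw [huniv, Finset.mem_insert, Finset.mem_singleton] at this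
    exact this
  set f : ClassGroup (𝓞 L) →* ClassGroup (𝓞 L) := (ClassGroup.mulEquiv (intAut σ)).toMonoidHom with hf
  have hiff : ∀ c : ClassGroup (𝓞 L), (∀ τ : L ≃ₐ[K] L, ClassGroup.mulEquiv (intAut τ) c = c) ↔ f c = c := by
    intro c
    refine ⟨fun h => h σ, fun h τ => ?_⟩
    rcases hmem τ with rfl | rfl
    · rw [mulEquiv_intAut_one, MulEquiv.refl_apply]
    · exact h
  have hcongr : Nat.card {c : ClassGroup (𝓞 L) // ∀ τ : L ≃ₐ[K] L, ClassGroup.mulEquiv (intAut τ) c = c} =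
      Nat.card {c : ClassGroup (𝓞 L) // f c = c} :=
    Nat.card_congr (Equiv.subtypeEquivRight hiff)
  rw [hcongr]
  refine padicValNat_two_card_fixed_eq_of_odd f fun c => ?_
  have hP : c * f c = classGroupExtend K L (classGroupNorm K L c) := by
    rw [classGroupExtend_classGroupNorm_eq_prod K L c, huniv, Finset.prod_pair (Ne.symm hσ1), mulEquiv_intAut_one,
      MulEquiv.refl_apply, hf, MulEquiv.coe_toMonoidHom]
  rw [hP]
  set d : ClassGroup (𝓞 K) := classGroupNorm K L c with hd
  -- `orderOf d = 2^a · m` with `m` odd; `d^m` has order `2^a`, hence capitulates; so `(i d)^m = 1`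
  obtain ⟨a, m, hm, ham⟩ := Nat.exists_eq_two_pow_mul_odd (orderOf_pos d).ne'
  have hdm : orderOf (d ^ m) = 2 ^ a := by
    rw [orderOf_pow' d hm.pos.ne', ham, Nat.gcd_mul_left_left, Nat.mul_div_cancel _ hm.pos]
  have h1 : classGroupExtend K L d ^ m = 1 := by
    rw [← map_pow]
    exact hcap _ ⟨a, hdm⟩
  exact Odd.of_dvd_nat hm (orderOf_dvd_of_pow_eq_one h1)

/-- ★★ **Chevalley read `2`-adically under capitulation.**  `L/K` Galois of degree `2` such that every class of `K` of `2`-power order capitulates in `L`: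
**`ord₂ [Cl(L) : Cl(L)²] + 1 + ord₂ [E_K : E_K ∩ N_{L/K} Lˣ] = ord₂ h_K + ord₂ (∏_𝔭 e_𝔭) + ord₂ (∏_{v∣∞} e_v)`** (tree `ambiguousClassNumberFormula` and the
previous theorem). [cite: Gras2003, IV.4] [cite: Lang1990, Ch. 13 §4, Lemma 4.1 (PDF p. 203)] [cite: Greenberg1976, §4] -/
theorem padicValNat_two_index_pow_two_add_eq_of_capitulation [IsGalois K L] (hdeg : Module.finrank K L = 2)
    (hcap : ∀ d : ClassGroup (𝓞 K), (∃ k : ℕ, orderOf d = 2 ^ k) → classGroupExtend K L d = 1) :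
    padicValNat 2 (powMonoidHom 2 : ClassGroup (𝓞 L) →* ClassGroup (𝓞 L)).range.index + 1 +
        padicValNat 2 ((unitsE L ⊓ (⊤ : Subgroup Lˣ).map (Herbrand.norm (L ≃ₐ[K] L))).relIndex
          (unitsE L ⊓ (unitsIncl K L).range)) =
      padicValNat 2 (classNumber K) + padicValNat 2 (∏ᶠ v : HeightOneSpectrum (𝓞 K), v.asIdeal.ramificationIdxIn (𝓞 L)) +
        padicValNat 2 (ArchHerbrand.archFactor K L) := by
  classical
  haveI : FiniteDimensional K L := Module.Finite.of_restrictScalars_finite ℚ K L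
  haveI : Fact (Nat.Prime 2) := ⟨Nat.prime_two⟩
  have hcard : Nat.card (L ≃ₐ[K] L) = 2 := by rw [IsGalois.card_aut_eq_finrank, hdeg]
  haveI : IsCyclic (L ≃ₐ[K] L) := isCyclic_of_prime_card hcard
  obtain ⟨σ, hσ⟩ := IsCyclic.exists_generator (α := L ≃ₐ[K] L)
  have hchev := ambiguousClassNumberFormula hσ
  rw [hdeg] at hchev
  have hfix : Nat.card {c : ClassGroup (𝓞 L) // ∀ τ : L ≃ₐ[K] L, ClassGroup.mulEquiv (intAut τ) c = c} ≠ 0 := by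
    haveI : Finite {c : ClassGroup (𝓞 L) // ∀ τ : L ≃ₐ[K] L, ClassGroup.mulEquiv (intAut τ) c = c} := inferInstance
    haveI : Nonempty {c : ClassGroup (𝓞 L) // ∀ τ : L ≃ₐ[K] L, ClassGroup.mulEquiv (intAut τ) c = c} := ⟨⟨1, fun τ => map_one _⟩⟩
    exact Nat.card_pos.ne'
  have hidx := (relIndex_unitsNorm_ne_zero hσ).1
  have hhK : classNumber K ≠ 0 := by rw [classNumber]; exact Fintype.card_ne_zero
  have harch : ArchHerbrand.archFactor K L ≠ 0 := ArchHerbrand.archFactor_ne_zero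
  have hprod : (∏ᶠ v : HeightOneSpectrum (𝓞 K), v.asIdeal.ramificationIdxIn (𝓞 L)) ≠ 0 := by
    rw [finprod_ramificationIdxIn_eq_pow_of_prime Nat.prime_two hdeg]; exact pow_ne_zero _ two_ne_zero
  have h := congrArg (padicValNat 2) hchev
  rw [padicValNat.mul (mul_ne_zero hfix two_ne_zero) hidx, padicValNat.mul hfix two_ne_zero,
    padicValNat.mul (mul_ne_zero hhK hprod) harch, padicValNat.mul hhK hprod, padicValNat.self one_lt_two,
    padicValNat_two_card_fixed_eq_of_capitulation hdeg hcap] at h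
  exact h

/-- ★★ **Unramified at infinity, `t` ramified primes, capitulating `2`-part: `ord₂ [Cl(L) : Cl(L)²] + 1 + ord₂ [E_K : E_K ∩ N Lˣ] = ord₂ h_K + t`**, so
`rank₂ Cl(L) ≤ ord₂ h_K + t − 1`. [cite: Gras2003, IV.4] [cite: Lang1990, Ch. 13 §4, Lemma 4.1 and proof of Lemma 4.2 (PDF pp. 203–204)] [cite: Greenberg1976, §4] -/
theorem padicValNat_two_index_pow_two_add_eq_ncard_of_capitulation [IsGalois K L] [IsUnramifiedAtInfinitePlaces K L]
    (hdeg : Module.finrank K L = 2)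
    (hcap : ∀ d : ClassGroup (𝓞 K), (∃ k : ℕ, orderOf d = 2 ^ k) → classGroupExtend K L d = 1) :
    padicValNat 2 (powMonoidHom 2 : ClassGroup (𝓞 L) →* ClassGroup (𝓞 L)).range.index + 1 +
        padicValNat 2 ((unitsE L ⊓ (⊤ : Subgroup Lˣ).map (Herbrand.norm (L ≃ₐ[K] L))).relIndex
          (unitsE L ⊓ (unitsIncl K L).range)) =
      padicValNat 2 (classNumber K) + {v : HeightOneSpectrum (𝓞 K) | v.asIdeal.ramificationIdxIn (𝓞 L) ≠ 1}.ncard := by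
  haveI : Fact (Nat.Prime 2) := ⟨Nat.prime_two⟩
  have h := padicValNat_two_index_pow_two_add_eq_of_capitulation hdeg hcap
  rwa [archFactor_eq_one, padicValNat_one_right, add_zero, finprod_ramificationIdxIn_eq_pow_of_prime Nat.prime_two hdeg,
    padicValNat.prime_pow] at h

end Literature.NumberTheory.NumberFields.AmbiguousClass

end
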